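import Mathlib
import HarnessLib

/-!
# Route `GenusKolyvaginAtTwo`, crux `KolyvaginExactAtTwo` (22137) → Q3-inner: McCallum's Lemma 5.3, the algebra —
# a left-non-degenerate pairing of CYCLIC groups of order `p^n` is non-zero on `(g, h)` when `p^{a} g ≠ 0`,
# `p^{b} h ≠ 0`, `n ≤ a + b + 1`

Seat `bsd-line-gk2-p2` g12 (cell `bsd-f1-sign2`). THEOREMS ONLY. This is the group-theoretic core of McCallum 1991,
Lemma 5.3 (*"two elements `y ∈ E(K_λ)/p^M`, `d ∈ H¹(K_λ, E)_{p^M}` pair nontrivially if … their orders multiply to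
more than `p^M`"*), isolated for the discharge of the displayed local terms `hloc₁`, `hloc₂` of
`…CasselsTateLocalTerms` (where `G = H¹(ℚ_λ, E[2^M])/𝓛_λ`, `H = 𝓛_λ`, both cyclic of order `2^M` at a Kolyvagin
prime of a `Δ < 0` curve, and the pairing is the Weil cup product followed by `inv_λ`). BSD is not proved by this.

References: [McCallumLMS1991] §5 Lemma 5.3.
-/

set_option linter.dupNamespace false -- tree convention: `Summit.BirchSwinnertonDyer.BirchSwinnertonDyer.Theorems` (summit = sub-problem)
set_option autoImplicit false

namespace Summit.BirchSwinnertonDyer.BirchSwinnertonDyer.Theorems.GenusExact.VisiblePairAtTwo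

/-- In a cyclic group of order `p^n` generated by `g₀`, `p^a • (k • g₀) ≠ 0` forces `¬ p^{n-a} ∣ k`. [folklore] -/
theorem not_pow_dvd_of_pow_zsmul_ne_zero {G : Type*} [AddCommGroup G] {p n a : ℕ} {g₀ : G}
    (hord : (p : ℤ) ^ n • g₀ = 0) {k : ℤ} (hk : ((p : ℤ) ^ a) • (k • g₀) ≠ 0) : ¬ (p : ℤ) ^ (n - a) ∣ k := by
  rintro ⟨c, rfl⟩
  apply hk
  by_cases han : a ≤ n
  · rw [smul_smul, ← mul_assoc, ← pow_add, Nat.add_sub_cancel' han, mul_comm, mul_smul, hord, smul_zero]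
  · push Not at han
    rw [smul_smul, ← mul_assoc, ← pow_add, show a + (n - a) = n + (a - n) by omega, pow_add, mul_assoc, mul_comm,
      mul_smul, hord, smul_zero]

/-- **McCallum's Lemma 5.3, the algebra.** Let `B : G × H → C` be bi-additive with trivial LEFT kernel, `G` and `H`
cyclic of order `p^n` (`p` prime). If `p^a g ≠ 0`, `p^b h ≠ 0` and `n ≤ a + b + 1` ("the orders multiply to more
than `p^n`"), then `B(g, h) ≠ 0`. [cite: McCallumLMS1991, §5 Lemma 5.3] -/
theorem pairing_ne_zero_of_isAddCyclic {G H C : Type*} [AddCommGroup G] [AddCommGroup H] [AddCommGroup C]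
    (B : G →+ H →+ C) {p : ℕ} (hp : p.Prime) {n : ℕ}
    [IsAddCyclic G] [IsAddCyclic H] (hG : Nat.card G = p ^ n) (hH : Nat.card H = p ^ n)
    (hleft : ∀ g : G, (∀ h, B g h = 0) → g = 0)
    {g : G} {h : H} {a b : ℕ} (hg : ((p : ℤ) ^ a) • g ≠ 0) (hh : ((p : ℤ) ^ b) • h ≠ 0) (hn : n ≤ a + b + 1) :
    B g h ≠ 0 := by
  haveI : Fact p.Prime := ⟨hp⟩
  have hpz : (p : ℤ) ≠ 0 := Int.natCast_ne_zero.mpr hp.ne_zero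
  haveI : Finite G := Nat.finite_of_card_ne_zero (by rw [hG]; exact pow_ne_zero n hp.ne_zero)
  haveI : Finite H := Nat.finite_of_card_ne_zero (by rw [hH]; exact pow_ne_zero n hp.ne_zero)
  obtain ⟨g₀, hg₀⟩ := IsAddCyclic.exists_generator (α := G)
  obtain ⟨h₀, hh₀⟩ := IsAddCyclic.exists_generator (α := H)
  have hordg : addOrderOf g₀ = p ^ n := by rw [← hG]; exact addOrderOf_eq_card_of_forall_mem_zmultiples hg₀
  have hordh : addOrderOf h₀ = p ^ n := by rw [← hH]; exact addOrderOf_eq_card_of_forall_mem_zmultiples hh₀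
  have hg₀n : (p : ℤ) ^ n • g₀ = 0 := by
    rw [← Nat.cast_pow, natCast_zsmul, ← hordg]; exact addOrderOf_nsmul_eq_zero g₀
  have hh₀n : (p : ℤ) ^ n • h₀ = 0 := by
    rw [← Nat.cast_pow, natCast_zsmul, ← hordh]; exact addOrderOf_nsmul_eq_zero h₀
  obtain ⟨k, rfl⟩ := AddSubgroup.mem_zmultiples_iff.mp (hg₀ g)
  obtain ⟨k', rfl⟩ := AddSubgroup.mem_zmultiples_iff.mp (hh₀ h)
  -- the value `c = B g₀ h₀` has order `p^n`: `p^{n-1} c ≠ 0`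
  set c := B g₀ h₀ with hc
  have hcn1 : n ≠ 0 → ((p : ℤ) ^ (n - 1)) • c ≠ 0 := by
    intro hn0 h0
    have hne : ((p : ℤ) ^ (n - 1)) • g₀ ≠ 0 := by
      intro h1
      have := addOrderOf_dvd_iff_zsmul_eq_zero |>.mpr h1
      rw [hordg, ← Nat.cast_pow, Int.natCast_dvd_natCast, Nat.pow_dvd_pow_iff_le_right hp.one_lt] at this
      omega
    apply hne
    refine hleft _ fun y ↦ ?_
    obtain ⟨l, rfl⟩ := AddSubgroup.mem_zmultiples_iff.mp (hh₀ y)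
    rw [map_zsmul, map_zsmul, AddMonoidHom.zsmul_apply, ← hc, h0, smul_zero]
  -- `B g h = k k' c`, and `p^n ∤ k k'`
  intro h0
  rw [map_zsmul, map_zsmul, AddMonoidHom.zsmul_apply, smul_smul, ← hc] at h0
  have hk : ¬ (p : ℤ) ^ (n - a) ∣ k := not_pow_dvd_of_pow_zsmul_ne_zero hg₀n hg
  have hk' : ¬ (p : ℤ) ^ (n - b) ∣ k' := not_pow_dvd_of_pow_zsmul_ne_zero hh₀n hh
  have hk0 : k ≠ 0 := fun h ↦ hk (by rw [h]; exact dvd_zero _)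
  have hk'0 : k' ≠ 0 := fun h ↦ hk' (by rw [h]; exact dvd_zero _)
  -- `p`-adic valuations
  have hvk : padicValInt p k < n - a := by
    by_contra hle
    push Not at hle
    exact hk ((padicValInt_dvd_iff (n - a) k).mpr (Or.inr hle))
  have hvk' : padicValInt p k' < n - b := by
    by_contra hle
    push Not at hle
    exact hk' ((padicValInt_dvd_iff (n - b) k').mpr (Or.inr hle))
  have hn0 : n ≠ 0 := by
    rintro rfl
    simp at hvk
  -- `c` has order exactly `p^n`
  have hcn : ((p : ℤ) ^ n) • c = 0 := by
    rw [hc, ← AddMonoidHom.zsmul_apply, ← map_zsmul, hg₀n, map_zero, AddMonoidHom.zero_apply]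
  have hordc : addOrderOf c = p ^ n := by
    have hdvd : addOrderOf c ∣ p ^ n := by
      have h := addOrderOf_dvd_iff_zsmul_eq_zero.mpr hcn
      rwa [← Nat.cast_pow, Int.natCast_dvd_natCast] at h
    obtain ⟨m, hm, hmeq⟩ := (Nat.dvd_prime_pow hp).mp hdvd
    rw [hmeq]
    rcases Nat.lt_or_ge m n with hlt | hge
    · exfalso
      apply hcn1 hn0
      rw [show n - 1 = (n - 1 - m) + m by omega, pow_add, mul_smul, ← Nat.cast_pow p m, natCast_zsmul, ← hmeq,
        addOrderOf_nsmul_eq_zero, smul_zero]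
    · rw [le_antisymm hm hge]
  -- `(k' k) • c = 0` forces `p^n ∣ k' k`, i.e. `v_p(k' k) ≥ n`: contradiction
  have hdvd : ((p : ℤ) ^ n) ∣ k' * k := by
    have h := addOrderOf_dvd_iff_zsmul_eq_zero.mpr h0
    rwa [hordc, Nat.cast_pow] at h
  have hv : padicValInt p (k' * k) ≤ n - 1 := by
    rw [padicValInt.mul hk'0 hk0]; omega
  rcases (padicValInt_dvd_iff n (k' * k)).mp hdvd with h1 | h1
  · exact mul_ne_zero hk'0 hk0 h1
  · omega

/-- An element of `2`-power (more generally `p`-power) order killed by an integer prime to `p` is `0`: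
if `p^n • z = 0`, `¬ p ∣ u` and `u • z = 0` then `z = 0`. [folklore] -/
theorem eq_zero_of_coprime_zsmul_eq_zero {C : Type*} [AddCommGroup C] {p : ℕ} (hp : p.Prime) {n : ℕ} {z : C}
    (hz : ((p : ℤ) ^ n) • z = 0) {u : ℤ} (hu : ¬ (p : ℤ) ∣ u) (huz : u • z = 0) : z = 0 := by
  have hcop : IsCoprime u ((p : ℤ) ^ n) :=
    ((Int.prime_iff_natAbs_prime.mpr (by simpa using hp)).coprime_iff_not_dvd.mpr hu).symm.pow_right
  obtain ⟨x, y, hxy⟩ := hcop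
  calc z = (x * u + y * (p : ℤ) ^ n) • z := by rw [hxy, one_smul]
    _ = 0 := by rw [add_smul, mul_smul, mul_smul, huz, hz, smul_zero, smul_zero, add_zero]

/-- **McCallum's Lemma 5.3, the algebra, one-sided cyclic form.** Let `B : G × H → C` be bi-additive with `G`
cyclic of order `p^{n'}`, `n' ≤ n`, and `C` killed by `p^n`. If `p^a g ≠ 0`, some `g₀` pairs non-trivially with
`p^b h`, and `n ≤ a + b + 1`, then `B(g, h) ≠ 0`. (Used with `G` = the image of `H¹(ℚ_λ, E[2^M])` in
`H¹(ℚ_λ, E)[2^M]` — cyclic at a Kolyvagin prime — and `H = 𝓛_λ`.) [cite: McCallumLMS1991, §5 Lemma 5.3] -/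
theorem pairing_ne_zero_of_isAddCyclic_left {G H C : Type*} [AddCommGroup G] [AddCommGroup H] [AddCommGroup C]
    (B : G →+ H →+ C) {p : ℕ} (hp : p.Prime) {n n' : ℕ} (hn' : n' ≤ n)
    [IsAddCyclic G] (hG : Nat.card G = p ^ n') (hC : ∀ z : C, ((p : ℤ) ^ n) • z = 0)
    {g : G} {h : H} {a b : ℕ} (hg : ((p : ℤ) ^ a) • g ≠ 0) (hh : ∃ g₀ : G, B g₀ (((p : ℤ) ^ b) • h) ≠ 0)
    (hn : n ≤ a + b + 1) : B g h ≠ 0 := by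
  haveI : Fact p.Prime := ⟨hp⟩
  haveI : Finite G := Nat.finite_of_card_ne_zero (by rw [hG]; exact pow_ne_zero n' hp.ne_zero)
  obtain ⟨g₁, hg₁⟩ := IsAddCyclic.exists_generator (α := G)
  have hordg : addOrderOf g₁ = p ^ n' := by rw [← hG]; exact addOrderOf_eq_card_of_forall_mem_zmultiples hg₁
  have hg₁n : (p : ℤ) ^ n' • g₁ = 0 := by
    rw [← Nat.cast_pow, natCast_zsmul, ← hordg]; exact addOrderOf_nsmul_eq_zero g₁
  obtain ⟨k, rfl⟩ := AddSubgroup.mem_zmultiples_iff.mp (hg₁ g)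
  obtain ⟨g₀, hg₀⟩ := hh
  obtain ⟨k₀, rfl⟩ := AddSubgroup.mem_zmultiples_iff.mp (hg₁ g₀)
  set c := B g₁ h with hc
  -- `p^b • c ≠ 0`
  have hcb : ((p : ℤ) ^ b) • c ≠ 0 := by
    intro h0
    apply hg₀
    rw [map_zsmul, map_zsmul, AddMonoidHom.zsmul_apply, ← hc, smul_comm, h0, smul_zero]
  -- `k = p^v u`, `v = v_p(k) ≤ n' - a - 1`
  have hk : ¬ (p : ℤ) ^ (n' - a) ∣ k := not_pow_dvd_of_pow_zsmul_ne_zero hg₁n hg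
  have hk0 : k ≠ 0 := fun h0 ↦ hk (by rw [h0]; exact dvd_zero _)
  have hvk : padicValInt p k < n' - a := by
    by_contra hle
    push Not at hle
    exact hk ((padicValInt_dvd_iff (n' - a) k).mpr (Or.inr hle))
  obtain ⟨u, hu⟩ : ((p : ℤ) ^ padicValInt p k) ∣ k := padicValInt_dvd k
  have hpu : ¬ (p : ℤ) ∣ u := by
    intro hdiv
    have h1 : (p : ℤ) ^ (padicValInt p k + 1) ∣ k := by
      obtain ⟨w, hw⟩ := hdiv
      exact ⟨w, by rw [pow_succ, mul_assoc, ← hw]; exact hu⟩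
    rcases (padicValInt_dvd_iff _ k).mp h1 with h2 | h2
    · exact hk0 h2
    · omega
  -- `B g h = u • p^v • c` with `v ≤ b`; if it vanished, `p^v • c = 0`, hence `p^b • c = 0`
  intro h0
  rw [map_zsmul, AddMonoidHom.zsmul_apply, ← hc, hu, mul_comm, mul_smul] at h0
  have hvc : ((p : ℤ) ^ padicValInt p k) • c = 0 :=
    eq_zero_of_coprime_zsmul_eq_zero hp (n := n) (by rw [smul_comm]; rw [hC, smul_zero]) hpu h0
  apply hcb
  rw [show b = (b - padicValInt p k) + padicValInt p k by omega, pow_add, mul_smul, hvc, smul_zero]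

end Summit.BirchSwinnertonDyer.BirchSwinnertonDyer.Theorems.GenusExact.VisiblePairAtTwo
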